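import Mathlib.Analysis.SpecialFunctions.Gamma.Deligne
import Mathlib.Analysis.SpecialFunctions.Gamma.Deriv
import Mathlib.Analysis.Complex.CauchyIntegral
import Mathlib.Analysis.Analytic.IsolatedZeros
import Mathlib.Analysis.Analytic.Uniqueness
import Mathlib.Analysis.Normed.Module.Connected
import Mathlib.LinearAlgebra.Complex.FiniteDimensional
import HarnessLib

/-!
# Rigidity of functional equations: two Γ-factors and two conductors for one L-function agree

Topic `Literature/NumberTheory/LFunctions`; namespace `Literature.NumberTheory.LFunctions`.  Pure complex
analysis (Mathlib only), used to compare the *Artin* completion `A^{s/2} γ_A(s) L(s)` and the *Hecke*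
completion `A'^{s/2} γ_H(s) L(s)` of one and the same Dirichlet series `L(s)` (an abelian Artin L-function
is a Hecke L-function, Neukirch VII (10.6)): if the Hecke completion satisfies a functional equation
`Λ_H(1-s) = W Λ'_H(s)` (Hecke, VII (8.6)) and the Artin completion divides a self-dual `Λ_Z(1-s) = Λ_Z(s)`
(the completed Dedekind zeta function of the field cut out, VII (5.10), through the Artin formalism), with
a cofactor that is again of Hecke type, then the Γ-shifts and the constants agree.  This replaces, in the
tree's route to Artin's functional equation (12.6) for characters of degree one, the local class field
theory behind VII (11.10) ("`𝔣(χ) = 𝔣(χ̃)`") and the archimedean reciprocity behind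
"`𝓛_∞(L|K, χ, s) = L_∞(χ̃, s)`" (VII §12, p. 540) — a deviation from the printed proof.

Main result `gammaFactor_rigidity` (aggregated form).  With `Γ(A, B; s) = Γ_ℝ(s)^A Γ_ℝ(s+1)^B Γ_ℂ(s)^m`:
let `P, P', Λ_Z, Λ_H, Λ'_H` be holomorphic on `ℂ ∖ {0, 1}` with, for `re s > 1`,
`Λ_Z(s) = κ₁^{s/2} Γ(A, B; s) P(s)`, `Λ_H(s) = κ₂^{s/2} Γ(A', B'; s) P(s)`, `Λ'_H(s) = κ₂^{s/2} Γ(A', B'; s) P'(s)`,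
`P'(s) = P(s) ≠ 0`, and `A + B = A' + B'`; if `Λ_Z(1-s) = Λ_Z(s)` off the integers and `Λ_H(1-s) = W Λ'_H(s)`
(`W ≠ 0`), then `A = A'` (hence `B = B'`) and `κ₁ = κ₂`.  Proof: the entire function
`D(s) = I_A(1-s) I_H(s) - W I_H(1-s) I_A(s)` (`I` = the reciprocal completions, entire by
`Complex.differentiable_Gammaℝ_inv`) satisfies `P · D = 0` on `ℂ ∖ {0,1}`, hence vanishes identically;
off the integers this reads `cot(πs/2)^{A-A'} = W (κ₂/κ₁)^{s-1/2}` (Mathlib's reflection formulas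
`Complex.inv_Gammaℝ_one_sub`, `Complex.inv_Gammaℝ_two_sub`), impossible near `s = 1` (resp. `s = 2`) unless
`A = A'`, and then `κ₁ = κ₂`.

## References

* J. Neukirch, *Algebraic Number Theory*, Springer 1999, Ch. VII §12 p. 540; §8 (8.6); §5 (5.10). [NeukirchANT1999]
-/

noncomputable section

open Complex Filter Topology

namespace Literature.NumberTheory.LFunctions

namespace Rigidity

/-! ## The set `ℂ ∖ ℤ` and the Gamma factors on it -/

/-- `s` is not an integer (file-local abbreviation of the inline hypothesis `∀ n : ℤ, s ≠ n` used elsewhere in the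
tree, e.g. `LFunctions/DedekindZeta.lean`). [folklore] -/
abbrev NonInt (s : ℂ) : Prop := ∀ n : ℤ, s ≠ n

/-- `1 - s ∉ ℤ` for `s ∉ ℤ`. [folklore] -/
theorem NonInt.one_sub {s : ℂ} (hs : NonInt s) : NonInt (1 - s) := fun n h ↦
  hs (1 - n) (by rw [Int.cast_sub, Int.cast_one, ← h]; ring)

/-- `s ≠ -n`. [folklore] -/
theorem NonInt.ne_neg_nat {s : ℂ} (hs : NonInt s) (n : ℕ) : s ≠ -n := fun h ↦
  hs (-n) (by rw [h, Int.cast_neg, Int.cast_natCast])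

/-- `s ≠ 0`. [folklore] -/
theorem NonInt.ne_zero {s : ℂ} (hs : NonInt s) : s ≠ 0 := fun h ↦ hs 0 (by rw [h, Int.cast_zero])

/-- `s ≠ 1`. [folklore] -/
theorem NonInt.ne_one {s : ℂ} (hs : NonInt s) : s ≠ 1 := fun h ↦ hs 1 (by rw [h, Int.cast_one])

/-- `s ∈ ℂ ∖ {0, 1}`. [folklore] -/
theorem NonInt.mem_compl {s : ℂ} (hs : NonInt s) : s ∈ ({0, 1}ᶜ : Set ℂ) := by
  simp only [Set.mem_compl_iff, Set.mem_insert_iff, Set.mem_singleton_iff, not_or]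
  exact ⟨hs.ne_zero, hs.ne_one⟩

/-- A number with nonzero imaginary part is not an integer. [folklore] -/
theorem NonInt.of_im_ne_zero {s : ℂ} (hs : s.im ≠ 0) : NonInt s := fun n h ↦ hs (by rw [h]; simp)

/-- `Γ_ℝ(s) ≠ 0` off the integers. [folklore] -/
theorem NonInt.Gammaℝ_ne_zero {s : ℂ} (hs : NonInt s) : Gammaℝ s ≠ 0 := by
  rw [Ne, Gammaℝ_eq_zero_iff, not_exists]
  intro n h
  exact hs (-(2 * n)) (by rw [h]; push_cast; ring)

/-- `Γ_ℝ(s+1) ≠ 0` off the integers. [folklore] -/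
theorem NonInt.Gammaℝ_add_one_ne_zero {s : ℂ} (hs : NonInt s) : Gammaℝ (s + 1) ≠ 0 := by
  rw [Ne, Gammaℝ_eq_zero_iff, not_exists]
  intro n h
  exact hs (-(2 * n) - 1) (by push_cast; linear_combination h)

/-- `Γ(s) ≠ 0` off the integers. [folklore] -/
theorem NonInt.Gamma_ne_zero {s : ℂ} (hs : NonInt s) : Gamma s ≠ 0 :=
  Complex.Gamma_ne_zero hs.ne_neg_nat

/-- `Γ_ℂ(s) ≠ 0` off the integers. [folklore] -/
theorem NonInt.Gammaℂ_ne_zero {s : ℂ} (hs : NonInt s) : Gammaℂ s ≠ 0 := by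
  rw [← Gammaℝ_mul_Gammaℝ_add_one]; exact mul_ne_zero hs.Gammaℝ_ne_zero hs.Gammaℝ_add_one_ne_zero

/-- `sin(πs/2) ≠ 0` off the integers. [folklore] -/
theorem NonInt.sin_ne_zero {s : ℂ} (hs : NonInt s) : Complex.sin (Real.pi * s / 2) ≠ 0 := by
  rw [Ne, Complex.sin_eq_zero_iff, not_exists]
  intro n h
  apply hs (2 * n)
  have hπ : (Real.pi : ℂ) ≠ 0 := by exact_mod_cast Real.pi_ne_zero
  field_simp at h
  push_cast
  linear_combination h

/-- `cos(πs/2) ≠ 0` off the integers. [folklore] -/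
theorem NonInt.cos_ne_zero {s : ℂ} (hs : NonInt s) : Complex.cos (Real.pi * s / 2) ≠ 0 := by
  rw [Ne, Complex.cos_eq_zero_iff, not_exists]
  intro n h
  apply hs (2 * n + 1)
  have hπ : (Real.pi : ℂ) ≠ 0 := by exact_mod_cast Real.pi_ne_zero
  field_simp at h
  push_cast
  linear_combination h

/-- **`Γ_ℝ(2-s) Γ_ℝ(s) sin(πs/2) = Γ_ℝ(1-s) Γ_ℝ(s+1) cos(πs/2)`** off the integers (Mathlib's reflection
formulas `inv_Gammaℝ_one_sub`, `inv_Gammaℝ_two_sub`). [folklore] -/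
theorem NonInt.reflection {s : ℂ} (hs : NonInt s) :
    Gammaℝ (2 - s) * Gammaℝ s * Complex.sin (Real.pi * s / 2) =
      Gammaℝ (1 - s) * Gammaℝ (s + 1) * Complex.cos (Real.pi * s / 2) := by
  have h1 := inv_Gammaℝ_one_sub hs.ne_neg_nat
  have h2 := inv_Gammaℝ_two_sub hs.ne_neg_nat
  have hne1 := hs.one_sub.Gammaℝ_ne_zero
  have hne2 : Gammaℝ (2 - s) ≠ 0 := by
    have := hs.one_sub.Gammaℝ_add_one_ne_zero; rwa [show 1 - s + 1 = 2 - s by ring] at this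
  have hne0 := hs.Gammaℝ_ne_zero
  have hne3 := hs.Gammaℝ_add_one_ne_zero
  field_simp at h1 h2
  rw [mul_comm s (Real.pi : ℂ)] at h1 h2
  -- `h1 : Γ_ℝ(s) = Γ_ℝ(1-s) Γ_ℂ(s) cos`, `h2 : Γ_ℝ(s+1) = Γ_ℂ(s) Γ_ℝ(2-s) sin`
  linear_combination (Gammaℝ (2 - s) * Complex.sin (Real.pi * s / 2)) * h1 -
    (Gammaℝ (1 - s) * Complex.cos (Real.pi * s / 2)) * h2

/-! ## Reciprocal Gamma factors (entire) -/

/-- `Γ(A, B; s) = Γ_ℝ(s)^A Γ_ℝ(s+1)^B Γ_ℂ(s)^m`. [folklore] -/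
def Gfac (A B m : ℕ) (s : ℂ) : ℂ := Gammaℝ s ^ A * Gammaℝ (s + 1) ^ B * Gammaℂ s ^ m

/-- The reciprocal completion factor `I(s) = κ^{-s/2} Γ_ℝ(s)^{-A} Γ_ℝ(s+1)^{-B} Γ_ℂ(s)^{-m}` (entire). [folklore] -/
def Ifac (κ : ℝ) (A B m : ℕ) (s : ℂ) : ℂ :=
  (κ : ℂ) ^ (-(s / 2)) * ((Gammaℝ s)⁻¹ ^ A * (Gammaℝ (s + 1))⁻¹ ^ B * ((Gammaℝ s)⁻¹ * (Gammaℝ (s + 1))⁻¹) ^ m)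

/-- `Γ_ℂ(s)⁻¹ = Γ_ℝ(s)⁻¹ Γ_ℝ(s+1)⁻¹` (Legendre, `Gammaℝ_mul_Gammaℝ_add_one`). [folklore] -/
theorem Gammaℂ_inv (s : ℂ) : (Gammaℂ s)⁻¹ = (Gammaℝ s)⁻¹ * (Gammaℝ (s + 1))⁻¹ := by
  rw [← Gammaℝ_mul_Gammaℝ_add_one, mul_inv]

/-- `I` is entire. [folklore] -/
theorem differentiable_Ifac {κ : ℝ} (hκ : 0 < κ) (A B m : ℕ) : Differentiable ℂ (Ifac κ A B m) := by
  have h1 : Differentiable ℂ fun s : ℂ ↦ (Gammaℝ (s + 1))⁻¹ :=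
    differentiable_Gammaℝ_inv.comp (differentiable_id.add_const 1)
  have h0 : Differentiable ℂ fun s : ℂ ↦ (κ : ℂ) ^ (-(s / 2)) :=
    Differentiable.const_cpow (by fun_prop) (Or.inl (Complex.ofReal_ne_zero.mpr hκ.ne'))
  unfold Ifac
  exact h0.mul (((differentiable_Gammaℝ_inv.pow A).mul (h1.pow B)).mul ((differentiable_Gammaℝ_inv.mul h1).pow m))

/-- `κ^{s/2} Γ(A,B;s) · I(s) = 1` wherever the Gamma factors do not vanish, e.g. `re s > 0`. [folklore] -/
theorem Gfac_mul_Ifac {κ : ℝ} (hκ : 0 < κ) (A B m : ℕ) {s : ℂ} (h0 : Gammaℝ s ≠ 0) (h1 : Gammaℝ (s + 1) ≠ 0) :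
    (κ : ℂ) ^ (s / 2) * Gfac A B m s * Ifac κ A B m s = 1 := by
  have hκ0 : (κ : ℂ) ≠ 0 := Complex.ofReal_ne_zero.mpr hκ.ne'
  have hc : (κ : ℂ) ^ (s / 2) ≠ 0 := by
    rw [Ne, Complex.cpow_eq_zero_iff, not_and_or]; exact Or.inl hκ0
  unfold Gfac Ifac
  rw [← Gammaℝ_mul_Gammaℝ_add_one, Complex.cpow_neg]
  field_simp
  rw [one_div, one_div, one_div, inv_pow, inv_pow, inv_pow, mul_pow]
  field_simp

/-- `Γ_ℝ(s) ≠ 0` for `re s > 1`. [folklore] -/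
theorem Gammaℝ_ne_zero_of_one_lt_re {s : ℂ} (hs : 1 < s.re) : Gammaℝ s ≠ 0 := Gammaℝ_ne_zero_of_re_pos (by linarith)
/-- `Γ_ℝ(s+1) ≠ 0` for `re s > 1`. [folklore] -/
theorem Gammaℝ_add_one_ne_zero_of_one_lt_re {s : ℂ} (hs : 1 < s.re) : Gammaℝ (s + 1) ≠ 0 :=
  Gammaℝ_ne_zero_of_re_pos (by simp; linarith)

/-! ## Identity theorems -/

/-- Identity theorem on `ℂ ∖ {0, 1}` from the half-plane `re s > 1`.  This is a deliberate Mathlib-only copy of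
`Literature.NumberTheory.Automorphic.eqOn_compl_zero_one_of_eqOn_one_lt_re`
(`Automorphic/ArtinLFunctionsAbelianConductorProofs.lean`), whose file imports the whole Artin/Hecke stack while
this file is kept free of number theory; a librarian may hoist both into a light shared analysis file. [folklore] -/
theorem eqOn_compl_of_eqOn_one_lt_re {f g : ℂ → ℂ}
    (hf : DifferentiableOn ℂ f ({0, 1}ᶜ : Set ℂ)) (hg : DifferentiableOn ℂ g ({0, 1}ᶜ : Set ℂ))
    (h : ∀ s : ℂ, 1 < s.re → f s = g s) : Set.EqOn f g ({0, 1}ᶜ : Set ℂ) := by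
  have hfin : ({0, 1} : Set ℂ).Finite := Set.toFinite _
  have hopen : IsOpen (({0, 1} : Set ℂ)ᶜ) := hfin.isClosed.isOpen_compl
  have hpc : IsPreconnected (({0, 1} : Set ℂ)ᶜ) :=
    (hfin.countable.isPathConnected_compl_of_one_lt_rank (Complex.rank_real_complex ▸ Nat.one_lt_ofNat)).isConnected.isPreconnected
  have hne : (2 : ℂ) ∈ (({0, 1} : Set ℂ)ᶜ) := by norm_num
  refine AnalyticOnNhd.eqOn_of_preconnected_of_eventuallyEq (𝕜 := ℂ) (hf.analyticOnNhd hopen) (hg.analyticOnNhd hopen) hpc hne ?_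
  refine eventually_of_mem ?_ (fun t (ht : 1 < t.re) ↦ h t ht)
  exact (continuous_re.isOpen_preimage _ isOpen_Ioi).mem_nhds (by simp : 1 < (2 : ℂ).re)

/-- **Transfer of `Λ = κ^{s/2} Γ P` to `P = Λ · I` on `ℂ ∖ {0,1}`.** [folklore] -/
theorem eqOn_mul_Ifac {Λ P : ℂ → ℂ} (hΛ : DifferentiableOn ℂ Λ ({0, 1}ᶜ : Set ℂ))
    (hP : DifferentiableOn ℂ P ({0, 1}ᶜ : Set ℂ)) {κ : ℝ} (hκ : 0 < κ) (A B m : ℕ)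
    (h : ∀ s : ℂ, 1 < s.re → Λ s = (κ : ℂ) ^ (s / 2) * Gfac A B m s * P s) :
    Set.EqOn P (fun s ↦ Λ s * Ifac κ A B m s) ({0, 1}ᶜ : Set ℂ) := by
  refine eqOn_compl_of_eqOn_one_lt_re hP (hΛ.mul (differentiable_Ifac hκ A B m).differentiableOn) fun s hs ↦ ?_
  rw [h s hs, show (κ : ℂ) ^ (s / 2) * Gfac A B m s * P s * Ifac κ A B m s =
    ((κ : ℂ) ^ (s / 2) * Gfac A B m s * Ifac κ A B m s) * P s by ring,
    Gfac_mul_Ifac hκ A B m (Gammaℝ_ne_zero_of_one_lt_re hs) (Gammaℝ_add_one_ne_zero_of_one_lt_re hs), one_mul]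

/-- **An entire function killed by a function not vanishing at `5/2` off the integers is zero.** [folklore] -/
theorem entire_eq_zero_of_mul_eq_zero {P D : ℂ → ℂ} (hP : DifferentiableOn ℂ P ({0, 1}ᶜ : Set ℂ))
    (hD : Differentiable ℂ D) (h : ∀ s : ℂ, NonInt s → P s * D s = 0) (h0 : P ((5 : ℂ) / 2) ≠ 0) (s : ℂ) :
    D s = 0 := by
  set s₀ : ℂ := (5 : ℂ) / 2 with hs₀
  have hs₀U : s₀ ∈ ({0, 1}ᶜ : Set ℂ) := by rw [hs₀]; norm_num
  have hopen : IsOpen (({0, 1} : Set ℂ)ᶜ) := (Set.toFinite _).isClosed.isOpen_compl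
  have hcont : ContinuousAt P s₀ := (hP.differentiableAt (hopen.mem_nhds hs₀U)).continuousAt
  -- `P ≠ 0` near `s₀`
  have hne : ∀ᶠ z in 𝓝 s₀, P z ≠ 0 := hcont.eventually_ne h0
  -- non-integers near `s₀`
  have hni : ∀ᶠ z in 𝓝 s₀, NonInt z := by
    have : Metric.ball s₀ (1 / 2) ∈ 𝓝 s₀ := Metric.ball_mem_nhds _ (by norm_num)
    refine Filter.eventually_of_mem this fun z hz n hn ↦ ?_
    rw [Metric.mem_ball, Complex.dist_eq] at hz
    rw [hn, hs₀] at hz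
    have hre : |((n : ℂ) - 5 / 2).re| ≤ ‖(n : ℂ) - 5 / 2‖ := Complex.abs_re_le_norm _
    simp only [Complex.sub_re, Complex.intCast_re, Complex.div_ofNat_re] at hre
    norm_num at hre
    have h2 : |(n : ℝ) - 5 / 2| < 1 / 2 := lt_of_le_of_lt hre hz
    rw [abs_lt] at h2
    have h3 : (2 : ℝ) < n := by linarith
    have h4 : (n : ℝ) < 3 := by linarith
    have h5 : (2 : ℤ) < n := by exact_mod_cast h3
    have h6 : n < (3 : ℤ) := by exact_mod_cast h4
    omega
  have hD0 : ∀ᶠ z in 𝓝 s₀, D z = 0 := (hne.and hni).mono fun z ⟨hz1, hz2⟩ ↦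
    (mul_eq_zero.mp (h z hz2)).resolve_left hz1
  have hDan : AnalyticOnNhd ℂ D Set.univ := hD.differentiableOn.analyticOnNhd isOpen_univ
  have := hDan.eqOn_zero_of_preconnected_of_eventuallyEq_zero isPreconnected_univ (Set.mem_univ s₀) hD0
  exact this (Set.mem_univ s)

/-- Two functions continuous at `1` which agree off the integers agree at `1`. [folklore] -/
theorem eq_at_one_of_eqOn_nonInt {f g : ℂ → ℂ} (hf : ContinuousAt f 1) (hg : ContinuousAt g 1)
    (h : ∀ s : ℂ, NonInt s → f s = g s) : f 1 = g 1 := by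
  -- the sequence `1 + i/(n+1) → 1` of non-integers
  set t : ℕ → ℝ := fun n ↦ 1 / ((n : ℝ) + 1) with ht
  set u : ℕ → ℂ := fun n ↦ 1 + (t n : ℂ) * Complex.I with hu
  have hu1 : Tendsto u atTop (𝓝 1) := by
    have h1 : Tendsto (fun n : ℕ ↦ ((t n : ℝ) : ℂ)) atTop (𝓝 0) := by
      have := (Complex.continuous_ofReal.tendsto 0).comp (tendsto_one_div_add_atTop_nhds_zero_nat (𝕜 := ℝ))
      rw [Complex.ofReal_zero] at this
      exact this
    have := h1.mul (tendsto_const_nhds (x := Complex.I))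
    rw [zero_mul] at this
    have h2 := (tendsto_const_nhds (x := (1 : ℂ))).add this
    rw [add_zero] at h2
    exact h2
  have hni : ∀ n, NonInt (u n) := fun n ↦ NonInt.of_im_ne_zero (by
    have : (u n).im = t n := by rw [hu]; simp
    rw [this, ht]; positivity)
  have hfu : Tendsto (f ∘ u) atTop (𝓝 (f 1)) := hf.tendsto.comp hu1
  have hgu : Tendsto (g ∘ u) atTop (𝓝 (g 1)) := hg.tendsto.comp hu1
  have heq : f ∘ u = g ∘ u := funext fun n ↦ h _ (hni n)
  rw [heq] at hfu
  exact tendsto_nhds_unique hfu hgu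

/-! ## The rigidity theorem -/

/-- Continuity of `s ↦ κ^{f(s)}`-type constants: `c(s) = κ₁^{-(1-s)/2} κ₂^{-s/2}`. [folklore] -/
theorem continuous_constPair {κ₁ κ₂ : ℝ} (h₁ : 0 < κ₁) (h₂ : 0 < κ₂) :
    Continuous fun s : ℂ ↦ (κ₁ : ℂ) ^ (-((1 - s) / 2)) * (κ₂ : ℂ) ^ (-(s / 2)) := by
  refine Continuous.mul ?_ ?_
  · exact Continuous.const_cpow (by fun_prop) (Or.inl (Complex.ofReal_ne_zero.mpr h₁.ne'))
  · exact Continuous.const_cpow (by fun_prop) (Or.inl (Complex.ofReal_ne_zero.mpr h₂.ne'))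

/-- `c(s) ≠ 0`. [folklore] -/
theorem constPair_ne_zero {κ₁ κ₂ : ℝ} (h₁ : 0 < κ₁) (h₂ : 0 < κ₂) (s : ℂ) :
    (κ₁ : ℂ) ^ (-((1 - s) / 2)) * (κ₂ : ℂ) ^ (-(s / 2)) ≠ 0 := by
  refine mul_ne_zero ?_ ?_ <;> rw [Ne, Complex.cpow_eq_zero_iff, not_and_or]
  · exact Or.inl (Complex.ofReal_ne_zero.mpr h₁.ne')
  · exact Or.inl (Complex.ofReal_ne_zero.mpr h₂.ne')

/-- The shift `c(s+2) = c(s) κ₁ κ₂⁻¹`. [folklore] -/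
theorem constPair_add_two {κ₁ κ₂ : ℝ} (h₁ : 0 < κ₁) (h₂ : 0 < κ₂) (s : ℂ) :
    (κ₁ : ℂ) ^ (-((1 - (s + 2)) / 2)) * (κ₂ : ℂ) ^ (-((s + 2) / 2)) =
      ((κ₁ : ℂ) ^ (-((1 - s) / 2)) * (κ₂ : ℂ) ^ (-(s / 2))) * κ₁ * (κ₂ : ℂ)⁻¹ := by
  have hκ₁ : (κ₁ : ℂ) ≠ 0 := Complex.ofReal_ne_zero.mpr h₁.ne'
  have hκ₂ : (κ₂ : ℂ) ≠ 0 := Complex.ofReal_ne_zero.mpr h₂.ne'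
  rw [show -((1 - (s + 2)) / 2) = -((1 - s) / 2) + 1 by ring, show -((s + 2) / 2) = -(s / 2) + (-1) by ring,
    Complex.cpow_add _ _ hκ₁, Complex.cpow_add _ _ hκ₂, Complex.cpow_one, Complex.cpow_neg_one]
  ring

/-- **The core of the rigidity argument**: if the entire function
`D(s) = I₁(1-s) I₂(s) - W I₂(1-s) I₁(s)` (`I₁ = Ifac κ₁ A B m`, `I₂ = Ifac κ₂ A' B' m`) vanishes identically and
`A + B = A' + B'`, then `A = A'` and `κ₁ = κ₂`. [folklore] -/
theorem rigidity_core {κ₁ κ₂ : ℝ} (h₁ : 0 < κ₁) (h₂ : 0 < κ₂) {W : ℂ} (hW : W ≠ 0)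
    {A B A' B' m : ℕ} (hAB : A + B = A' + B')
    (hD0 : ∀ s : ℂ, Ifac κ₁ A B m (1 - s) * Ifac κ₂ A' B' m s - W * (Ifac κ₂ A' B' m (1 - s) * Ifac κ₁ A B m s) = 0) :
    A = A' ∧ κ₁ = κ₂ := by
  set I₁ := Ifac κ₁ A B m with hI₁
  set I₂ := Ifac κ₂ A' B' m with hI₂
  set D : ℂ → ℂ := fun s ↦ I₁ (1 - s) * I₂ s - W * (I₂ (1 - s) * I₁ s) with hD
  replace hD0 : ∀ s, D s = 0 := fun s ↦ hD0 s
  -- off the integers: the explicit form of `D = 0`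
  -- abbreviations for the four Gamma values and the constants
  have key : ∀ s : ℂ, NonInt s →
      ((κ₁ : ℂ) ^ (-((1 - s) / 2)) * (κ₂ : ℂ) ^ (-(s / 2))) *
          ((Gammaℝ (1 - s))⁻¹ ^ A * (Gammaℝ (2 - s))⁻¹ ^ B * ((Gammaℝ s)⁻¹ ^ A' * (Gammaℝ (s + 1))⁻¹ ^ B')) =
        W * ((κ₂ : ℂ) ^ (-((1 - s) / 2)) * (κ₁ : ℂ) ^ (-(s / 2))) *
          ((Gammaℝ (1 - s))⁻¹ ^ A' * (Gammaℝ (2 - s))⁻¹ ^ B' * ((Gammaℝ s)⁻¹ ^ A * (Gammaℝ (s + 1))⁻¹ ^ B)) := by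
    intro s hs
    have h := hD0 s
    simp only [hD, hI₁, hI₂, Ifac, sub_eq_zero, show 1 - s + 1 = 2 - s by ring] at h
    -- cancel the common `Γ_ℂ` part
    have hc : ((Gammaℝ (1 - s))⁻¹ * (Gammaℝ (2 - s))⁻¹) ^ m * ((Gammaℝ s)⁻¹ * (Gammaℝ (s + 1))⁻¹) ^ m ≠ 0 := by
      have h2s : Gammaℝ (2 - s) ≠ 0 := by
        have := hs.one_sub.Gammaℝ_add_one_ne_zero; rwa [show 1 - s + 1 = 2 - s by ring] at this
      apply mul_ne_zero <;> apply pow_ne_zero <;> apply mul_ne_zero <;> apply inv_ne_zero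
      exacts [hs.one_sub.Gammaℝ_ne_zero, h2s, hs.Gammaℝ_ne_zero, hs.Gammaℝ_add_one_ne_zero]
    apply mul_right_cancel₀ hc
    linear_combination h
  -- the Gamma values off the integers
  have hG : ∀ s : ℂ, NonInt s → Gammaℝ (1 - s) ≠ 0 ∧ Gammaℝ (2 - s) ≠ 0 ∧ Gammaℝ s ≠ 0 ∧ Gammaℝ (s + 1) ≠ 0 := by
    intro s hs
    refine ⟨hs.one_sub.Gammaℝ_ne_zero, ?_, hs.Gammaℝ_ne_zero, hs.Gammaℝ_add_one_ne_zero⟩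
    have := hs.one_sub.Gammaℝ_add_one_ne_zero; rwa [show 1 - s + 1 = 2 - s by ring] at this
  -- Step 1: `A = A'`
  have hAA : A = A' := by
    rcases Nat.lt_trichotomy A A' with hlt | heq | hgt
    · -- `A' = A + k`, `B = B' + k`, `k > 0`: `c₁ sin^k = W c₂ cos^k`, contradiction at `s = 1`
      exfalso
      obtain ⟨k, hk⟩ := Nat.exists_eq_add_of_lt hlt
      have hB : B = B' + (k + 1) := by omega
      have hA : A' = A + (k + 1) := by omega
      -- the identity `c₁(s) sin^{k+1} = W c₂(s) cos^{k+1}` off the integers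
      have hid : ∀ s : ℂ, NonInt s →
          ((κ₁ : ℂ) ^ (-((1 - s) / 2)) * (κ₂ : ℂ) ^ (-(s / 2))) * Complex.sin (Real.pi * s / 2) ^ (k + 1) =
            W * ((κ₂ : ℂ) ^ (-((1 - s) / 2)) * (κ₁ : ℂ) ^ (-(s / 2))) * Complex.cos (Real.pi * s / 2) ^ (k + 1) := by
        intro s hs
        obtain ⟨g1, g2, g0, g3⟩ := hG s hs
        have h := key s hs
        rw [hA, hB, pow_add, pow_add] at h
        -- cancel `u^A v^{B'} x^A y^{B'}`
        have hc : (Gammaℝ (1 - s))⁻¹ ^ A * (Gammaℝ (2 - s))⁻¹ ^ B' * (Gammaℝ s)⁻¹ ^ A * (Gammaℝ (s + 1))⁻¹ ^ B' ≠ 0 := by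
          apply mul_ne_zero; apply mul_ne_zero; apply mul_ne_zero
          all_goals apply pow_ne_zero; apply inv_ne_zero
          exacts [g1, g2, g0, g3]
        have h' : ((κ₁ : ℂ) ^ (-((1 - s) / 2)) * (κ₂ : ℂ) ^ (-(s / 2))) *
            ((Gammaℝ (2 - s))⁻¹ ^ (k + 1) * (Gammaℝ s)⁻¹ ^ (k + 1)) =
            W * ((κ₂ : ℂ) ^ (-((1 - s) / 2)) * (κ₁ : ℂ) ^ (-(s / 2))) *
              ((Gammaℝ (1 - s))⁻¹ ^ (k + 1) * (Gammaℝ (s + 1))⁻¹ ^ (k + 1)) := by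
          apply mul_right_cancel₀ hc
          linear_combination h
        -- pass to Gamma values and use the reflection formula
        have hrefl := hs.reflection
        have e : (Gammaℝ (2 - s))⁻¹ * (Gammaℝ s)⁻¹ * Complex.cos (Real.pi * s / 2) =
            (Gammaℝ (1 - s))⁻¹ * (Gammaℝ (s + 1))⁻¹ * Complex.sin (Real.pi * s / 2) := by
          set co := Complex.cos (Real.pi * s / 2)
          set si := Complex.sin (Real.pi * s / 2)
          field_simp
          linear_combination -hrefl
        -- multiply `h'` by `cos^{k+1}` and rewrite with `e`
        have h'' := congrArg (fun z ↦ z * Complex.cos (Real.pi * s / 2) ^ (k + 1)) h'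
        rw [show ((κ₁ : ℂ) ^ (-((1 - s) / 2)) * (κ₂ : ℂ) ^ (-(s / 2))) *
            ((Gammaℝ (2 - s))⁻¹ ^ (k + 1) * (Gammaℝ s)⁻¹ ^ (k + 1)) * Complex.cos (Real.pi * s / 2) ^ (k + 1) =
            ((κ₁ : ℂ) ^ (-((1 - s) / 2)) * (κ₂ : ℂ) ^ (-(s / 2))) *
              ((Gammaℝ (2 - s))⁻¹ * (Gammaℝ s)⁻¹ * Complex.cos (Real.pi * s / 2)) ^ (k + 1) by ring, e] at h''
        -- now cancel `(u y)^{k+1}`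
        have hc2 : ((Gammaℝ (1 - s))⁻¹ * (Gammaℝ (s + 1))⁻¹) ^ (k + 1) ≠ 0 :=
          pow_ne_zero _ (mul_ne_zero (inv_ne_zero g1) (inv_ne_zero g3))
        apply mul_right_cancel₀ hc2
        linear_combination h''
      -- evaluate at `s = 1` by continuity
      have hc1 := continuous_constPair h₁ h₂
      have hc2 := continuous_constPair h₂ h₁
      have hlim := eq_at_one_of_eqOn_nonInt (f := fun s ↦ ((κ₁ : ℂ) ^ (-((1 - s) / 2)) * (κ₂ : ℂ) ^ (-(s / 2))) *
          Complex.sin (Real.pi * s / 2) ^ (k + 1))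
        (g := fun s ↦ W * ((κ₂ : ℂ) ^ (-((1 - s) / 2)) * (κ₁ : ℂ) ^ (-(s / 2))) * Complex.cos (Real.pi * s / 2) ^ (k + 1))
        (by fun_prop) (by fun_prop) hid
      rw [show (Real.pi : ℂ) * 1 / 2 = Real.pi / 2 by ring, Complex.cos_pi_div_two, Complex.sin_pi_div_two, one_pow,
        mul_one, zero_pow (Nat.succ_ne_zero k), mul_zero] at hlim
      exact constPair_ne_zero h₁ h₂ 1 hlim
    · exact heq
    · -- `A = A' + k`, `B' = B + k`: `c₁ cos^k = W c₂ sin^k`, contradiction at `s = 1`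
      exfalso
      obtain ⟨k, hk⟩ := Nat.exists_eq_add_of_lt hgt
      have hA : A = A' + (k + 1) := by omega
      have hB : B' = B + (k + 1) := by omega
      have hid : ∀ s : ℂ, NonInt s →
          ((κ₁ : ℂ) ^ (-((1 - s) / 2)) * (κ₂ : ℂ) ^ (-(s / 2))) * Complex.cos (Real.pi * s / 2) ^ (k + 1) =
            W * ((κ₂ : ℂ) ^ (-((1 - s) / 2)) * (κ₁ : ℂ) ^ (-(s / 2))) * Complex.sin (Real.pi * s / 2) ^ (k + 1) := by
        intro s hs
        obtain ⟨g1, g2, g0, g3⟩ := hG s hs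
        have h := key s hs
        rw [hA, hB, pow_add, pow_add] at h
        have hc : (Gammaℝ (1 - s))⁻¹ ^ A' * (Gammaℝ (2 - s))⁻¹ ^ B * (Gammaℝ s)⁻¹ ^ A' * (Gammaℝ (s + 1))⁻¹ ^ B ≠ 0 := by
          apply mul_ne_zero; apply mul_ne_zero; apply mul_ne_zero
          all_goals apply pow_ne_zero; apply inv_ne_zero
          exacts [g1, g2, g0, g3]
        have h' : ((κ₁ : ℂ) ^ (-((1 - s) / 2)) * (κ₂ : ℂ) ^ (-(s / 2))) *
            ((Gammaℝ (1 - s))⁻¹ ^ (k + 1) * (Gammaℝ (s + 1))⁻¹ ^ (k + 1)) =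
            W * ((κ₂ : ℂ) ^ (-((1 - s) / 2)) * (κ₁ : ℂ) ^ (-(s / 2))) *
              ((Gammaℝ (2 - s))⁻¹ ^ (k + 1) * (Gammaℝ s)⁻¹ ^ (k + 1)) := by
          apply mul_right_cancel₀ hc
          linear_combination h
        have hrefl := hs.reflection
        have e : (Gammaℝ (1 - s))⁻¹ * (Gammaℝ (s + 1))⁻¹ * Complex.sin (Real.pi * s / 2) =
            (Gammaℝ (2 - s))⁻¹ * (Gammaℝ s)⁻¹ * Complex.cos (Real.pi * s / 2) := by
          set co := Complex.cos (Real.pi * s / 2)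
          set si := Complex.sin (Real.pi * s / 2)
          field_simp
          linear_combination hrefl
        have h'' := congrArg (fun z ↦ z * Complex.sin (Real.pi * s / 2) ^ (k + 1)) h'
        rw [show ((κ₁ : ℂ) ^ (-((1 - s) / 2)) * (κ₂ : ℂ) ^ (-(s / 2))) *
            ((Gammaℝ (1 - s))⁻¹ ^ (k + 1) * (Gammaℝ (s + 1))⁻¹ ^ (k + 1)) * Complex.sin (Real.pi * s / 2) ^ (k + 1) =
            ((κ₁ : ℂ) ^ (-((1 - s) / 2)) * (κ₂ : ℂ) ^ (-(s / 2))) *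
              ((Gammaℝ (1 - s))⁻¹ * (Gammaℝ (s + 1))⁻¹ * Complex.sin (Real.pi * s / 2)) ^ (k + 1) by ring, e] at h''
        have hc2 : ((Gammaℝ (2 - s))⁻¹ * (Gammaℝ s)⁻¹) ^ (k + 1) ≠ 0 :=
          pow_ne_zero _ (mul_ne_zero (inv_ne_zero g2) (inv_ne_zero g0))
        apply mul_right_cancel₀ hc2
        linear_combination h''
      have hlim := eq_at_one_of_eqOn_nonInt (f := fun s ↦ ((κ₁ : ℂ) ^ (-((1 - s) / 2)) * (κ₂ : ℂ) ^ (-(s / 2))) *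
          Complex.cos (Real.pi * s / 2) ^ (k + 1))
        (g := fun s ↦ W * ((κ₂ : ℂ) ^ (-((1 - s) / 2)) * (κ₁ : ℂ) ^ (-(s / 2))) * Complex.sin (Real.pi * s / 2) ^ (k + 1))
        (by
          have := continuous_constPair h₁ h₂
          fun_prop) (by
          have := continuous_constPair h₂ h₁
          fun_prop) hid
      rw [show (Real.pi : ℂ) * 1 / 2 = Real.pi / 2 by ring, Complex.cos_pi_div_two, Complex.sin_pi_div_two, one_pow,
        mul_one, zero_pow (Nat.succ_ne_zero k), mul_zero] at hlim
      exact mul_ne_zero hW (constPair_ne_zero h₂ h₁ 1) hlim.symm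
  refine ⟨hAA, ?_⟩
  -- Step 2: `κ₁ = κ₂` from `c₁(s) = W c₂(s)` at `s` and `s + 2`
  subst hAA
  have hBB : B = B' := by omega
  subst hBB
  have hid : ∀ s : ℂ, NonInt s →
      (κ₁ : ℂ) ^ (-((1 - s) / 2)) * (κ₂ : ℂ) ^ (-(s / 2)) = W * ((κ₂ : ℂ) ^ (-((1 - s) / 2)) * (κ₁ : ℂ) ^ (-(s / 2))) := by
    intro s hs
    obtain ⟨g1, g2, g0, g3⟩ := hG s hs
    have hc : (Gammaℝ (1 - s))⁻¹ ^ A * (Gammaℝ (2 - s))⁻¹ ^ B * ((Gammaℝ s)⁻¹ ^ A * (Gammaℝ (s + 1))⁻¹ ^ B) ≠ 0 :=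
      mul_ne_zero (mul_ne_zero (pow_ne_zero _ (inv_ne_zero g1)) (pow_ne_zero _ (inv_ne_zero g2)))
        (mul_ne_zero (pow_ne_zero _ (inv_ne_zero g0)) (pow_ne_zero _ (inv_ne_zero g3)))
    apply mul_right_cancel₀ hc
    linear_combination key s hs
  have s₀ni : NonInt ((5 : ℂ) / 2) := fun n hn ↦ by
    have := congrArg Complex.re hn
    simp at this
    have h2 : (2 : ℝ) * n = 5 := by linarith
    have h3 : (2 : ℤ) * n = 5 := by exact_mod_cast h2
    omega
  have s₁ni : NonInt ((5 : ℂ) / 2 + 2) := fun n hn ↦ s₀ni (n - 2) (by rw [Int.cast_sub]; push_cast; linear_combination hn)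
  have e0 := hid _ s₀ni
  have e2 := hid _ s₁ni
  rw [constPair_add_two h₁ h₂, constPair_add_two h₂ h₁, e0] at e2
  have hne := constPair_ne_zero h₂ h₁ ((5 : ℂ) / 2)
  have hκ₁ : (κ₁ : ℂ) ≠ 0 := Complex.ofReal_ne_zero.mpr h₁.ne'
  have hκ₂ : (κ₂ : ℂ) ≠ 0 := Complex.ofReal_ne_zero.mpr h₂.ne'
  -- `κ₁/κ₂ = κ₂/κ₁`
  have h3 : (κ₁ : ℂ) * (κ₂ : ℂ)⁻¹ = κ₂ * (κ₁ : ℂ)⁻¹ := by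
    apply mul_left_cancel₀ (mul_ne_zero hW hne)
    linear_combination e2
  have h4 : (κ₁ : ℝ) ^ 2 = κ₂ ^ 2 := by
    have : (κ₁ : ℂ) ^ 2 = (κ₂ : ℂ) ^ 2 := by field_simp at h3; linear_combination h3
    exact_mod_cast this
  nlinarith [sq_nonneg (κ₁ - κ₂), sq_nonneg (κ₁ + κ₂)]


/-- **Rigidity of the Γ-factor and of the constant in a functional equation.**  Let `P, P', Λ_Z, Λ_H, Λ'_H`
be holomorphic on `ℂ ∖ {0, 1}`, `κ₁, κ₂ > 0`, `W ≠ 0`, `A + B = A' + B'`, and suppose for `re s > 1`: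
`Λ_Z(s) = κ₁^{s/2} Γ(A,B;s) P(s)`, `Λ_H(s) = κ₂^{s/2} Γ(A',B';s) P(s)`, `Λ'_H(s) = κ₂^{s/2} Γ(A',B';s) P'(s)`,
`P'(s) = P(s) ≠ 0`; and the functional equations `Λ_Z(1-s) = Λ_Z(s)`, `Λ_H(1-s) = W Λ'_H(s)` off the integers
(where the continuations may take junk values).  Then `A = A'` and `κ₁ = κ₂`. [folklore] -/
theorem gammaFactor_rigidity {P P' ΛZ ΛH ΛH' : ℂ → ℂ} {κ₁ κ₂ : ℝ} (h₁ : 0 < κ₁) (h₂ : 0 < κ₂) {W : ℂ} (hW : W ≠ 0)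
    {A B A' B' m : ℕ} (hAB : A + B = A' + B')
    (hP : DifferentiableOn ℂ P ({0, 1}ᶜ : Set ℂ)) (hP' : DifferentiableOn ℂ P' ({0, 1}ᶜ : Set ℂ))
    (hZ : DifferentiableOn ℂ ΛZ ({0, 1}ᶜ : Set ℂ)) (hH : DifferentiableOn ℂ ΛH ({0, 1}ᶜ : Set ℂ))
    (hH' : DifferentiableOn ℂ ΛH' ({0, 1}ᶜ : Set ℂ))
    (hZs : ∀ s : ℂ, 1 < s.re → ΛZ s = (κ₁ : ℂ) ^ (s / 2) * Gfac A B m s * P s)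
    (hHs : ∀ s : ℂ, 1 < s.re → ΛH s = (κ₂ : ℂ) ^ (s / 2) * Gfac A' B' m s * P s)
    (hH's : ∀ s : ℂ, 1 < s.re → ΛH' s = (κ₂ : ℂ) ^ (s / 2) * Gfac A' B' m s * P' s)
    (hPP' : ∀ s : ℂ, 1 < s.re → P' s = P s) (hP0 : ∀ s : ℂ, 1 < s.re → P s ≠ 0)
    (hZfe : ∀ s : ℂ, NonInt s → ΛZ (1 - s) = ΛZ s) (hHfe : ∀ s : ℂ, NonInt s → ΛH (1 - s) = W * ΛH' s) :
    A = A' ∧ κ₁ = κ₂ := by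
  -- the reciprocal factors and the transfers to `ℂ ∖ {0,1}`
  set I₁ := Ifac κ₁ A B m with hI₁
  set I₂ := Ifac κ₂ A' B' m with hI₂
  have hT1 := eqOn_mul_Ifac hZ hP h₁ A B m hZs
  have hT2 := eqOn_mul_Ifac hH hP h₂ A' B' m hHs
  have hT3 := eqOn_mul_Ifac hH' hP' h₂ A' B' m hH's
  have hT4 : Set.EqOn P' P ({0, 1}ᶜ : Set ℂ) := eqOn_compl_of_eqOn_one_lt_re hP' hP hPP'
  -- `P · D = 0` off the integers, `D` entire
  set D : ℂ → ℂ := fun s ↦ I₁ (1 - s) * I₂ s - W * (I₂ (1 - s) * I₁ s) with hD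
  have hDd : Differentiable ℂ D := by
    have d1 := differentiable_Ifac h₁ A B m
    have d2 := differentiable_Ifac h₂ A' B' m
    have hs : Differentiable ℂ fun s : ℂ ↦ 1 - s := by fun_prop
    exact ((d1.comp hs).mul d2).sub ((differentiable_const W).mul ((d2.comp hs).mul d1))
  have hPD : ∀ s : ℂ, NonInt s → P s * D s = 0 := by
    intro s hs
    have hsU := hs.mem_compl
    have hs'U := hs.one_sub.mem_compl
    -- `P(1-s) I₁(s) = P(s) I₁(1-s)`
    have e1 : P (1 - s) * I₁ s = P s * I₁ (1 - s) := by
      rw [show P (1 - s) = ΛZ (1 - s) * I₁ (1 - s) from hT1 hs'U, hZfe s hs, show P s = ΛZ s * I₁ s from hT1 hsU]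
      ring
    -- `P(1-s) I₂(s) = W P(s) I₂(1-s)`
    have e2 : P (1 - s) * I₂ s = W * P s * I₂ (1 - s) := by
      rw [show P (1 - s) = ΛH (1 - s) * I₂ (1 - s) from hT2 hs'U, hHfe s hs, ← show P' s = P s from hT4 hsU,
        show P' s = ΛH' s * I₂ s from hT3 hsU]
      ring
    simp only [hD]
    linear_combination -(I₂ s) * e1 + I₁ s * e2
  have hP52 : P ((5 : ℂ) / 2) ≠ 0 := hP0 _ (by norm_num)
  have hD0 : ∀ s, D s = 0 := entire_eq_zero_of_mul_eq_zero hP hDd hPD hP52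
  exact rigidity_core h₁ h₂ hW hAB fun s ↦ hD0 s

/-- **Two Gamma completions which agree on `re s > 1` have the same reciprocal factor everywhere**
(the reciprocal factors are entire). [folklore] -/
theorem Ifac_eq_of_eqOn {κ κ' : ℝ} (hκ : 0 < κ) (hκ' : 0 < κ') {A B m A' B' m' : ℕ}
    (h : ∀ s : ℂ, 1 < s.re → (κ : ℂ) ^ (s / 2) * Gfac A B m s = (κ' : ℂ) ^ (s / 2) * Gfac A' B' m' s) (s : ℂ) :
    Ifac κ A B m s = Ifac κ' A' B' m' s := by
  have hI := differentiable_Ifac hκ A B m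
  have hI' := differentiable_Ifac hκ' A' B' m'
  have hev : ∀ᶠ z in 𝓝 (2 : ℂ), Ifac κ A B m z = Ifac κ' A' B' m' z := by
    refine eventually_of_mem ((continuous_re.isOpen_preimage _ isOpen_Ioi).mem_nhds (by simp : 1 < (2 : ℂ).re))
      fun z (hz : 1 < z.re) ↦ ?_
    have g0 := Gammaℝ_ne_zero_of_one_lt_re hz
    have g1 := Gammaℝ_add_one_ne_zero_of_one_lt_re hz
    have e := Gfac_mul_Ifac hκ A B m g0 g1
    have e' := Gfac_mul_Ifac hκ' A' B' m' g0 g1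
    rw [h z hz] at e
    -- `γ' I = 1 = γ' I'` with `γ' ≠ 0`
    have hγ : (κ' : ℂ) ^ (z / 2) * Gfac A' B' m' z ≠ 0 := fun h0 ↦ by rw [h0, zero_mul] at e'; exact zero_ne_one e'
    exact mul_left_cancel₀ hγ (e.trans e'.symm)
  exact (hI.differentiableOn.analyticOnNhd isOpen_univ).eqOn_of_preconnected_of_eventuallyEq
    (hI'.differentiableOn.analyticOnNhd isOpen_univ) isPreconnected_univ (Set.mem_univ (2 : ℂ)) hev (Set.mem_univ s)

/-- **Rigidity, zeta form.**  As `gammaFactor_rigidity`, but with the self-dual object given as an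
L-function continuation `Z` (holomorphic on `ℂ ∖ {0,1}`, `= P` on `re s > 1`) with an explicit completion
`κ_Z^{s/2} Γ(A_Z, B_Z; s)` (with its own `Γ_ℂ`-multiplicity `m_Z`) satisfying `γ_Z(1-s) Z(1-s) = γ_Z(s) Z(s)` off
the integers, the Hecke functional equation off the integers, and the Artin completion known to coincide with it on `re s > 1`:
`κ_Z^{s/2} Γ(A_Z,B_Z;s) = κ₁^{s/2} Γ(A,B;s)` there (this is how the completed Dedekind zeta function of the
field cut out by a character and the product of the completed Artin L-functions of its powers present
themselves).  Conclusion: `A = A'` and `κ₁ = κ₂`. [folklore] -/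
theorem gammaFactor_rigidity_of_zeta {Z P P' ΛH ΛH' : ℂ → ℂ} {κZ κ₁ κ₂ : ℝ} (hZ0 : 0 < κZ) (h₁ : 0 < κ₁)
    (h₂ : 0 < κ₂) {W : ℂ} (hW : W ≠ 0) {AZ BZ mZ A B A' B' m : ℕ} (hAB : A + B = A' + B')
    (hZ : DifferentiableOn ℂ Z ({0, 1}ᶜ : Set ℂ)) (hP : DifferentiableOn ℂ P ({0, 1}ᶜ : Set ℂ))
    (hP' : DifferentiableOn ℂ P' ({0, 1}ᶜ : Set ℂ)) (hH : DifferentiableOn ℂ ΛH ({0, 1}ᶜ : Set ℂ))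
    (hH' : DifferentiableOn ℂ ΛH' ({0, 1}ᶜ : Set ℂ))
    (hZP : ∀ s : ℂ, 1 < s.re → Z s = P s)
    (hγ : ∀ s : ℂ, 1 < s.re → (κZ : ℂ) ^ (s / 2) * Gfac AZ BZ mZ s = (κ₁ : ℂ) ^ (s / 2) * Gfac A B m s)
    (hZfe : ∀ s : ℂ, NonInt s → (κZ : ℂ) ^ ((1 - s) / 2) * Gfac AZ BZ mZ (1 - s) * Z (1 - s) =
      (κZ : ℂ) ^ (s / 2) * Gfac AZ BZ mZ s * Z s)
    (hHs : ∀ s : ℂ, 1 < s.re → ΛH s = (κ₂ : ℂ) ^ (s / 2) * Gfac A' B' m s * P s)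
    (hH's : ∀ s : ℂ, 1 < s.re → ΛH' s = (κ₂ : ℂ) ^ (s / 2) * Gfac A' B' m s * P' s)
    (hPP' : ∀ s : ℂ, 1 < s.re → P' s = P s) (hP0 : ∀ s : ℂ, 1 < s.re → P s ≠ 0)
    (hHfe : ∀ s : ℂ, NonInt s → ΛH (1 - s) = W * ΛH' s) :
    A = A' ∧ κ₁ = κ₂ := by
  set I₁ := Ifac κ₁ A B m with hI₁
  set I₂ := Ifac κ₂ A' B' m with hI₂
  have hT0 : Set.EqOn P Z ({0, 1}ᶜ : Set ℂ) := eqOn_compl_of_eqOn_one_lt_re hP hZ fun s hs ↦ (hZP s hs).symm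
  have hT2 := eqOn_mul_Ifac hH hP h₂ A' B' m hHs
  have hT3 := eqOn_mul_Ifac hH' hP' h₂ A' B' m hH's
  have hT4 : Set.EqOn P' P ({0, 1}ᶜ : Set ℂ) := eqOn_compl_of_eqOn_one_lt_re hP' hP hPP'
  have hIeq : ∀ s, Ifac κZ AZ BZ mZ s = I₁ s := Ifac_eq_of_eqOn hZ0 h₁ hγ
  set D : ℂ → ℂ := fun s ↦ I₁ (1 - s) * I₂ s - W * (I₂ (1 - s) * I₁ s) with hD
  have hDd : Differentiable ℂ D := by
    have d1 := differentiable_Ifac h₁ A B m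
    have d2 := differentiable_Ifac h₂ A' B' m
    have hs : Differentiable ℂ fun s : ℂ ↦ 1 - s := by fun_prop
    exact ((d1.comp hs).mul d2).sub ((differentiable_const W).mul ((d2.comp hs).mul d1))
  have hPD : ∀ s : ℂ, NonInt s → P s * D s = 0 := by
    intro s hs
    have hsU := hs.mem_compl
    have hs'U := hs.one_sub.mem_compl
    -- `P(1-s) I₁(s) = P(s) I₁(1-s)` from the self-duality of `Z`
    have e1 : P (1 - s) * I₁ s = P s * I₁ (1 - s) := by
      have g := Gfac_mul_Ifac hZ0 AZ BZ mZ hs.Gammaℝ_ne_zero hs.Gammaℝ_add_one_ne_zero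
      have g' := Gfac_mul_Ifac hZ0 AZ BZ mZ hs.one_sub.Gammaℝ_ne_zero hs.one_sub.Gammaℝ_add_one_ne_zero
      have h := congrArg (fun z ↦ z * (Ifac κZ AZ BZ mZ s * Ifac κZ AZ BZ mZ (1 - s))) (hZfe s hs)
      have h' : Z (1 - s) * Ifac κZ AZ BZ mZ s = Z s * Ifac κZ AZ BZ mZ (1 - s) := by
        linear_combination h + Z s * Ifac κZ AZ BZ mZ (1 - s) * g - Z (1 - s) * Ifac κZ AZ BZ mZ s * g'
      rw [hIeq, hIeq] at h'
      rw [hT0 hs'U, hT0 hsU]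
      exact h'
    have e2 : P (1 - s) * I₂ s = W * P s * I₂ (1 - s) := by
      rw [show P (1 - s) = ΛH (1 - s) * I₂ (1 - s) from hT2 hs'U, hHfe s hs, ← show P' s = P s from hT4 hsU,
        show P' s = ΛH' s * I₂ s from hT3 hsU]
      ring
    simp only [hD]
    linear_combination -(I₂ s) * e1 + I₁ s * e2
  have hP52 : P ((5 : ℂ) / 2) ≠ 0 := hP0 _ (by norm_num)
  have hD0 : ∀ s, D s = 0 := entire_eq_zero_of_mul_eq_zero hP hDd hPD hP52
  exact rigidity_core h₁ h₂ hW hAB fun s ↦ hD0 s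

end Rigidity

end Literature.NumberTheory.LFunctions
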